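import Mathlib.Algebra.Order.Field.Basic
import Mathlib.Tactic.Ring
import Mathlib.Tactic.Linarith
import Mathlib.Tactic.Positivity
import Summits.Ventures.CertifiedArithmetic.LowPrec.SRTreeEnvelopes
import HarnessLib

/-!
# Stochastic rounding into a finite format, X′: the uniform refinement beyond the hull; headroom

HONEST FRAMING: certified error envelopes and provably optimal rounding/accumulation schemes for
low-precision formats under stated cost models; every table by two implementations; no hardware or
vendor claims.

Support file for the saturation analysis (`SRSaturationCoupling`, `SRSaturationTail`,
`SRSaturationFormats`). Given a finite format `F ⊆ [lo, hi]` with `lo, hi ∈ F` and candidate gap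
`≤ G` on its hull (for a minifloat: `lo, hi = ∓maxRat`, `G` = top-binade spacing), the REFINEMENT

  `extendBy F lo hi G N = F ∪ {hi + G, hi + 2G, …, hi + N G} ∪ {lo − G, …, lo − N G}`

continues `F` beyond its hull with uniform spacing `G`. It is an artificial number system used only as
a comparison process: SR summation in `extendBy …` never saturates as long as every intermediate sum
stays in `[lo − N G, hi + N G]`, and it rounds exactly like `F` inside `[lo, hi]`.

* `subset_extendBy`, `mem_of_mem_extendBy_of_inHull` — the two halves of `Agrees F (extendBy …)`
  (no new point inside the hull of `F`);
* `inHull_extendBy` — `[lo − N G, hi + N G]` lies in the hull of the refinement;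
* `gap_extendBy` — the refinement has candidate gap `≤ G` on ITS whole hull;
* `HeadroomT lo hi h T` — every internal node's EXACT partial sum lies in `[lo + h, hi − h]`
  (decidable: `headroomTB`); `RoomT` — the sure range `s_v ± (m_l + m_r)·G` of a node's pre-rounding
  value fits in a window; `noSatT_of_roomT` — **sure-range lemma**: with gap `≤ G` on the hull and the
  window inside the hull, `RoomT ⇒ NoSatT` (no saturation on ANY branch); `gapLET_of_hull`;
  `roomT_of_headroomT` — headroom `h ≥ 0` in `F` gives room in the refinement with `N ≥ m − 1` layers.

Elementary; no literature claim (the construction is ours, for the proof only).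
-/

namespace Summit.Ventures.CertifiedArithmetic.LowPrec.SR

open Literature.ComputerArithmetic.ConnollyHighamMary2021
open Finset STree

variable {K : Type*} [Field K] [LinearOrder K] [IsStrictOrderedRing K]

/-! ### The refinement -/

/-- `F` continued by `N` equally spaced points (spacing `G`) above `hi` and below `lo`. -/
def extendBy (F : Finset K) (lo hi G : K) (N : ℕ) : Finset K :=
  F ∪ (range N).image (fun k : ℕ => hi + ((k : K) + 1) * G)
    ∪ (range N).image (fun k : ℕ => lo - ((k : K) + 1) * G)

omit [IsStrictOrderedRing K] in
/-- The refinement contains the format. -/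
theorem subset_extendBy (F : Finset K) (lo hi G : K) (N : ℕ) : F ⊆ extendBy F lo hi G N :=
  fun _ hx => mem_union_left _ (mem_union_left _ hx)

omit [IsStrictOrderedRing K] in
/-- Membership in the refinement. -/
theorem mem_extendBy_iff {F : Finset K} {lo hi G : K} {N : ℕ} {y : K} :
    y ∈ extendBy F lo hi G N ↔ y ∈ F ∨ (∃ k < N, y = hi + ((k : K) + 1) * G)
      ∨ ∃ k < N, y = lo - ((k : K) + 1) * G := by
  simp only [extendBy, mem_union, mem_image, mem_range, or_assoc]
  constructor
  · rintro (h | ⟨k, hk, rfl⟩ | ⟨k, hk, rfl⟩)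
    · exact Or.inl h
    · exact Or.inr (Or.inl ⟨k, hk, rfl⟩)
    · exact Or.inr (Or.inr ⟨k, hk, rfl⟩)
  · rintro (h | ⟨k, hk, rfl⟩ | ⟨k, hk, rfl⟩)
    · exact Or.inl h
    · exact Or.inr (Or.inl ⟨k, hk, rfl⟩)
    · exact Or.inr (Or.inr ⟨k, hk, rfl⟩)

omit [IsStrictOrderedRing K] in
/-- The `k`-th point above `hi` is in the refinement (`k < N`). -/
theorem above_mem_extendBy (F : Finset K) (lo hi G : K) {N k : ℕ} (hk : k < N) :
    hi + ((k : K) + 1) * G ∈ extendBy F lo hi G N :=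
  mem_extendBy_iff.mpr (Or.inr (Or.inl ⟨k, hk, rfl⟩))

omit [IsStrictOrderedRing K] in
/-- The `k`-th point below `lo` is in the refinement (`k < N`). -/
theorem below_mem_extendBy (F : Finset K) (lo hi G : K) {N k : ℕ} (hk : k < N) :
    lo - ((k : K) + 1) * G ∈ extendBy F lo hi G N :=
  mem_extendBy_iff.mpr (Or.inr (Or.inr ⟨k, hk, rfl⟩))

/-- Every point of the refinement lies in `[lo − N G, hi + N G]` (when `F ⊆ [lo, hi]`, `0 ≤ G`). -/
theorem mem_extendBy_bounds {F : Finset K} {lo hi G : K} {N : ℕ} (hG : 0 ≤ G) (hlohi : lo ≤ hi)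
    (hbd : ∀ y ∈ F, lo ≤ y ∧ y ≤ hi) {y : K} (hy : y ∈ extendBy F lo hi G N) :
    lo - N * G ≤ y ∧ y ≤ hi + N * G := by
  have hNG : 0 ≤ (N : K) * G := by positivity
  rcases mem_extendBy_iff.mp hy with h | ⟨k, hk, rfl⟩ | ⟨k, hk, rfl⟩
  · exact ⟨by linarith [(hbd y h).1], by linarith [(hbd y h).2]⟩
  · have hk' : (k : K) + 1 ≤ N := by exact_mod_cast hk
    have : ((k : K) + 1) * G ≤ N * G := mul_le_mul_of_nonneg_right hk' hG
    constructor <;> nlinarith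
  · have hk' : (k : K) + 1 ≤ N := by exact_mod_cast hk
    have : ((k : K) + 1) * G ≤ N * G := mul_le_mul_of_nonneg_right hk' hG
    constructor <;> nlinarith

/-- **No new point inside the hull**: a point of the refinement lying in the hull of `F` is in `F`
(with `F ⊆ [lo, hi]`, `0 < G`). Together with `subset_extendBy` this is `Agrees F (extendBy …)`. -/
theorem mem_of_mem_extendBy_of_inHull {F : Finset K} {lo hi G : K} {N : ℕ} (hG : 0 < G)
    (hbd : ∀ y ∈ F, lo ≤ y ∧ y ≤ hi) {y : K} (hy : y ∈ extendBy F lo hi G N) (hin : InHull F y) :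
    y ∈ F := by
  rcases mem_extendBy_iff.mp hy with h | ⟨k, _, rfl⟩ | ⟨k, _, rfl⟩
  · exact h
  · exfalso
    obtain ⟨z, hz, hyz⟩ := hin.2
    have : 0 < ((k : K) + 1) * G := by positivity
    linarith [(hbd z hz).2]
  · exfalso
    obtain ⟨z, hz, hzy⟩ := hin.1
    have : 0 < ((k : K) + 1) * G := by positivity
    linarith [(hbd z hz).1]

omit [IsStrictOrderedRing K] in
/-- `[lo − N G, hi + N G]` lies in the hull of the refinement (`lo, hi ∈ F`). -/
theorem inHull_extendBy {F : Finset K} {lo hi G : K} {N : ℕ} (hlo : lo ∈ F) (hhi : hi ∈ F)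
    {x : K} (h1 : lo - N * G ≤ x) (h2 : x ≤ hi + N * G) : InHull (extendBy F lo hi G N) x := by
  cases N with
  | zero =>
      simp only [Nat.cast_zero, zero_mul, sub_zero, add_zero] at h1 h2
      exact ⟨⟨lo, subset_extendBy F lo hi G 0 hlo, h1⟩, ⟨hi, subset_extendBy F lo hi G 0 hhi, h2⟩⟩
  | succ M =>
      push_cast at h1 h2
      exact ⟨⟨_, below_mem_extendBy F lo hi G (Nat.lt_succ_self M), h1⟩,
        ⟨_, above_mem_extendBy F lo hi G (Nat.lt_succ_self M), h2⟩⟩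

/-- Candidate gap of the refinement ABOVE `hi`: for `hi < c` in its hull, `⌈c⌉ − ⌊c⌋ ≤ G`. -/
theorem gap_extendBy_above {F : Finset K} {lo hi G : K} {N : ℕ} (hG : 0 < G) (hlohi : lo ≤ hi)
    (hhi : hi ∈ F) (hbd : ∀ y ∈ F, lo ≤ y ∧ y ≤ hi) {c : K} (hc : InHull (extendBy F lo hi G N) c)
    (hgt : hi < c) :
    roundUp (extendBy F lo hi G N) c - roundDown (extendBy F lo hi G N) c ≤ G := by
  classical
  obtain ⟨z, hz, hcz⟩ := hc.2
  have hzb := (mem_extendBy_bounds hG.le hlohi hbd hz).2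
  -- least `k` with `c ≤ hi + (k+1) G`; it is `< N`
  have hex : ∃ k : ℕ, c ≤ hi + ((k : K) + 1) * G := by
    cases N with
    | zero => simp only [Nat.cast_zero, zero_mul, add_zero] at hzb; linarith
    | succ M => exact ⟨M, by push_cast at hzb; linarith⟩
  obtain ⟨k₀, hk₀, hmin⟩ : ∃ k₀ : ℕ, c ≤ hi + ((k₀ : K) + 1) * G ∧
      ∀ k < k₀, ¬ c ≤ hi + ((k : K) + 1) * G :=
    ⟨Nat.find hex, Nat.find_spec hex, fun k hk => Nat.find_min hex hk⟩
  -- `hi + k₀ G ≤ c` (minimality; for `k₀ = 0` this is `hi < c`)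
  have hlow : hi + (k₀ : K) * G ≤ c := by
    by_cases h0 : k₀ = 0
    · rw [h0, Nat.cast_zero, zero_mul, add_zero]; exact hgt.le
    · have hpos : 0 < k₀ := Nat.pos_of_ne_zero h0
      have h := hmin (k₀ - 1) (Nat.sub_lt hpos Nat.one_pos)
      have hcast : ((k₀ - 1 : ℕ) : K) + 1 = k₀ := by rw [Nat.cast_sub hpos, Nat.cast_one]; ring
      rw [hcast, not_le] at h
      exact h.le
  have hk₀N : k₀ < N := by
    by_contra hge
    rw [not_lt] at hge
    cases N with
    | zero => simp only [Nat.cast_zero, zero_mul, add_zero] at hzb; linarith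
    | succ M =>
        push_cast at hzb
        exact hmin M (by omega) (hcz.trans hzb)
  have hup : roundUp (extendBy F lo hi G N) c ≤ hi + ((k₀ : K) + 1) * G :=
    roundUp_le_of_mem (above_mem_extendBy F lo hi G hk₀N) hk₀
  -- lower candidate: `hi + k₀ G` (`= hi` for `k₀ = 0`) is in the refinement and `≤ c`
  have hdn : hi + (k₀ : K) * G ≤ roundDown (extendBy F lo hi G N) c := by
    by_cases h0 : k₀ = 0
    · rw [h0, Nat.cast_zero, zero_mul, add_zero]
      exact le_roundDown_of_mem (subset_extendBy F lo hi G N hhi) hgt.le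
    · have hpos : 0 < k₀ := Nat.pos_of_ne_zero h0
      have hcast : ((k₀ - 1 : ℕ) : K) + 1 = k₀ := by rw [Nat.cast_sub hpos, Nat.cast_one]; ring
      have hmem := above_mem_extendBy F lo hi G (N := N) (k := k₀ - 1) (by omega)
      rw [hcast] at hmem
      exact le_roundDown_of_mem hmem hlow
  nlinarith

/-- Candidate gap of the refinement BELOW `lo`: for `c < lo` in its hull, `⌈c⌉ − ⌊c⌋ ≤ G`. -/
theorem gap_extendBy_below {F : Finset K} {lo hi G : K} {N : ℕ} (hG : 0 < G) (hlohi : lo ≤ hi)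
    (hlo : lo ∈ F) (hbd : ∀ y ∈ F, lo ≤ y ∧ y ≤ hi) {c : K} (hc : InHull (extendBy F lo hi G N) c)
    (hlt : c < lo) :
    roundUp (extendBy F lo hi G N) c - roundDown (extendBy F lo hi G N) c ≤ G := by
  classical
  obtain ⟨z, hz, hzc⟩ := hc.1
  have hzb := (mem_extendBy_bounds hG.le hlohi hbd hz).1
  have hex : ∃ k : ℕ, lo - ((k : K) + 1) * G ≤ c := by
    cases N with
    | zero => simp only [Nat.cast_zero, zero_mul, sub_zero] at hzb; linarith
    | succ M => exact ⟨M, by push_cast at hzb; linarith⟩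
  obtain ⟨k₀, hk₀, hmin⟩ : ∃ k₀ : ℕ, lo - ((k₀ : K) + 1) * G ≤ c ∧
      ∀ k < k₀, ¬ lo - ((k : K) + 1) * G ≤ c :=
    ⟨Nat.find hex, Nat.find_spec hex, fun k hk => Nat.find_min hex hk⟩
  have hupp : c ≤ lo - (k₀ : K) * G := by
    by_cases h0 : k₀ = 0
    · rw [h0, Nat.cast_zero, zero_mul, sub_zero]; exact hlt.le
    · have hpos : 0 < k₀ := Nat.pos_of_ne_zero h0
      have h := hmin (k₀ - 1) (Nat.sub_lt hpos Nat.one_pos)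
      have hcast : ((k₀ - 1 : ℕ) : K) + 1 = k₀ := by rw [Nat.cast_sub hpos, Nat.cast_one]; ring
      rw [hcast, not_le] at h
      exact h.le
  have hk₀N : k₀ < N := by
    by_contra hge
    rw [not_lt] at hge
    cases N with
    | zero => simp only [Nat.cast_zero, zero_mul, sub_zero] at hzb; linarith
    | succ M =>
        push_cast at hzb
        exact hmin M (by omega) (hzb.trans hzc)
  have hdn : lo - ((k₀ : K) + 1) * G ≤ roundDown (extendBy F lo hi G N) c :=
    le_roundDown_of_mem (below_mem_extendBy F lo hi G hk₀N) hk₀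
  have hup : roundUp (extendBy F lo hi G N) c ≤ lo - (k₀ : K) * G := by
    by_cases h0 : k₀ = 0
    · rw [h0, Nat.cast_zero, zero_mul, sub_zero]
      exact roundUp_le_of_mem (subset_extendBy F lo hi G N hlo) hlt.le
    · have hpos : 0 < k₀ := Nat.pos_of_ne_zero h0
      have hcast : ((k₀ - 1 : ℕ) : K) + 1 = k₀ := by rw [Nat.cast_sub hpos, Nat.cast_one]; ring
      have hmem := below_mem_extendBy F lo hi G (N := N) (k := k₀ - 1) (by omega)
      rw [hcast] at hmem
      exact roundUp_le_of_mem hmem hupp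
  nlinarith

/-- **The refinement has candidate gap `≤ G` on its whole hull** if `F` has gap `≤ G` on its hull. -/
theorem gap_extendBy {F : Finset K} {lo hi G : K} {N : ℕ} (hG : 0 < G) (hlo : lo ∈ F) (hhi : hi ∈ F)
    (hbd : ∀ y ∈ F, lo ≤ y ∧ y ≤ hi) (hgap : ∀ c, InHull F c → roundUp F c - roundDown F c ≤ G)
    (c : K) (hc : InHull (extendBy F lo hi G N) c) :
    roundUp (extendBy F lo hi G N) c - roundDown (extendBy F lo hi G N) c ≤ G := by
  have hlohi : lo ≤ hi := (hbd lo hlo).2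
  rcases le_or_gt c hi with hle | hgt
  swap
  · exact gap_extendBy_above hG hlohi hhi hbd hc hgt
  rcases le_or_gt lo c with hge | hlt
  swap
  · exact gap_extendBy_below hG hlohi hlo hbd hc hlt
  -- inside `[lo, hi]`: the candidates of `F` bracket `c` and lie in the refinement
  have hin : InHull F c := ⟨⟨lo, hlo, hge⟩, ⟨hi, hhi, hle⟩⟩
  have h1 : roundUp (extendBy F lo hi G N) c ≤ roundUp F c :=
    roundUp_le_of_mem (subset_extendBy F lo hi G N (roundUp_mem hin.2)) (le_roundUp F c)
  have h2 : roundDown F c ≤ roundDown (extendBy F lo hi G N) c :=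
    le_roundDown_of_mem (subset_extendBy F lo hi G N (roundDown_mem hin.1)) (roundDown_le F c)
  linarith [hgap c hin]

/-! ### Headroom and the sure range -/

/-- `HeadroomT lo hi h T`: every internal node's EXACT partial sum `s_v` satisfies
`lo + h ≤ s_v ≤ hi − h` (headroom `h` inside `[lo, hi]`; a condition on the DATA only). -/
def HeadroomT (lo hi h : K) : STree K → Prop
  | .leaf _ => True
  | .node l r => HeadroomT lo hi h l ∧ HeadroomT lo hi h r ∧
      lo + h ≤ l.exact + r.exact ∧ l.exact + r.exact ≤ hi - h

/-- Boolean evaluator of `HeadroomT` (kernel certificates). -/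
def headroomTB [DecidableLE K] (lo hi h : K) : STree K → Bool
  | .leaf _ => true
  | .node l r => headroomTB lo hi h l && headroomTB lo hi h r &&
      decide (lo + h ≤ l.exact + r.exact) && decide (l.exact + r.exact ≤ hi - h)

omit [IsStrictOrderedRing K] in
/-- `headroomTB` computes `HeadroomT`. -/
theorem headroomTB_iff [DecidableLE K] (lo hi h : K) : ∀ T : STree K,
    headroomTB lo hi h T = true ↔ HeadroomT lo hi h T
  | .leaf _ => by simp [headroomTB, HeadroomT]
  | .node l r => by
      simp only [headroomTB, HeadroomT, Bool.and_eq_true, headroomTB_iff lo hi h l,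
        headroomTB_iff lo hi h r, decide_eq_true_iff, and_assoc]

/-- `HeadroomT` is decidable (via `headroomTB`). -/
instance instDecidableHeadroomT [DecidableLE K] (lo hi h : K) (T : STree K) :
    Decidable (HeadroomT lo hi h T) :=
  decidable_of_iff _ (headroomTB_iff lo hi h T)

/-- Headroom is monotone in `h`. -/
theorem HeadroomT.mono {lo hi h h' : K} (hh : h' ≤ h) : ∀ {T : STree K},
    HeadroomT lo hi h T → HeadroomT lo hi h' T
  | .leaf _, _ => trivial
  | .node _ _, ⟨hl, hr, h1, h2⟩ => ⟨hl.mono hh, hr.mono hh, by linarith, by linarith⟩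

/-- `RoomT lo' hi' G T`: at every node `v = (l, r)` the SURE RANGE of the pre-rounding value,
`s_v ± (m_l + m_r)·G` (`m` = number of roundings below), fits in the window `[lo', hi']`. -/
def RoomT (lo' hi' G : K) : STree K → Prop
  | .leaf _ => True
  | .node l r => RoomT lo' hi' G l ∧ RoomT lo' hi' G r ∧
      lo' + ((l.nodes : K) + r.nodes) * G ≤ l.exact + r.exact ∧
      l.exact + r.exact + ((l.nodes : K) + r.nodes) * G ≤ hi'

omit [IsStrictOrderedRing K] in
/-- `GapLET G` on every branch of every tree from a gap bound valid on the whole hull. -/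
theorem gapLET_of_hull {F : Finset K} (hF : F.Nonempty) {G : K}
    (hgap : ∀ c, InHull F c → roundUp F c - roundDown F c ≤ G) : ∀ T : STree K, GapLET F G T
  | .leaf _ => trivial
  | .node l r => ⟨gapLET_of_hull hF hgap l, gapLET_of_hull hF hgap r,
      allOut_of_forall F l (fun _ => allOut_of_forall F r (fun _ => hgap _ (clamp_inHull hF _)))⟩

/-- **Sure-range lemma**: if `F'` has gap `≤ G` on its hull and the window `[lo', hi']` lies in the
hull, then `RoomT lo' hi' G T` forces NO SATURATION ON ANY BRANCH (`NoSatT F' T`): by induction every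
subtree value is within `m·G` of its exact sum (`allOut_abs_sub_le`), so every pre-rounding value stays
in the window. -/
theorem noSatT_of_roomT {F' : Finset K} (hF' : F'.Nonempty) {G lo' hi' : K}
    (hgap : ∀ c, InHull F' c → roundUp F' c - roundDown F' c ≤ G)
    (hH : ∀ c, lo' ≤ c → c ≤ hi' → InHull F' c) :
    ∀ T : STree K, RoomT lo' hi' G T → NoSatT F' T
  | .leaf _, _ => trivial
  | .node l r, ⟨hl, hr, h1, h2⟩ => by
      have hnl := noSatT_of_roomT hF' hgap hH l hl
      have hnr := noSatT_of_roomT hF' hgap hH r hr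
      refine ⟨hnl, hnr, ?_⟩
      have hal := allOut_abs_sub_le F' G l hnl (gapLET_of_hull hF' hgap l)
      have har := allOut_abs_sub_le F' G r hnr (gapLET_of_hull hF' hgap r)
      refine allOut_mono F' l (fun a ha => allOut_mono F' r (fun b hb => ?_) har) hal
      rw [abs_le] at ha hb
      rw [add_mul] at h1 h2
      exact hH _ (by linarith) (by linarith)

/-- **Headroom gives room in the refinement**: headroom `h ≥ 0` inside `[lo, hi]` and `N + 1 ≥ m`
layers (`m = T.nodes`) give `RoomT (lo − N G) (hi + N G) G T`. -/
theorem roomT_of_headroomT {lo hi h G : K} (hh : 0 ≤ h) (hG : 0 ≤ G) {N : ℕ} :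
    ∀ {T : STree K}, T.nodes ≤ N + 1 → HeadroomT lo hi h T → RoomT (lo - N * G) (hi + N * G) G T
  | .leaf _, _, _ => trivial
  | .node l r, hm, ⟨hl, hr, h1, h2⟩ => by
      simp only [STree.nodes] at hm
      have hml : l.nodes ≤ N + 1 := by omega
      have hmr : r.nodes ≤ N + 1 := by omega
      refine ⟨roomT_of_headroomT hh hG hml hl, roomT_of_headroomT hh hG hmr hr, ?_, ?_⟩
      · have hc : (l.nodes : K) + r.nodes ≤ N := by exact_mod_cast (by omega : l.nodes + r.nodes ≤ N)
        have := mul_le_mul_of_nonneg_right hc hG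
        linarith
      · have hc : (l.nodes : K) + r.nodes ≤ N := by exact_mod_cast (by omega : l.nodes + r.nodes ≤ N)
        have := mul_le_mul_of_nonneg_right hc hG
        linarith

/-- In the saturating evaluation every NODE value is a format value, hence within `hi − lo` of any
point of `[lo, hi]`; with root headroom, `|ŝ_T − ∑ leaves| ≤ hi − lo` surely (leaf trees: `0`). -/
theorem allOut_abs_sub_exact_le {F : Finset K} (hF : F.Nonempty) {lo hi h : K} (hh : 0 ≤ h)
    (hbd : ∀ y ∈ F, lo ≤ y ∧ y ≤ hi) :
    ∀ {T : STree K}, HeadroomT lo hi h T → AllOut F T (fun v => |v - T.exact| ≤ hi - lo)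
  | .leaf x, _ => by
      simp only [AllOut, STree.exact, sub_self, abs_zero, sub_nonneg]
      exact (hbd _ hF.choose_spec).1.trans (hbd _ hF.choose_spec).2
  | .node l r, ⟨_, _, h1, h2⟩ => by
      refine allOut_mono F (.node l r) (fun v hv => ?_) (allOut_mem_node F hF l r)
      simp only [STree.exact]
      rw [abs_le]
      exact ⟨by linarith [(hbd v hv).1], by linarith [(hbd v hv).2]⟩

end Summit.Ventures.CertifiedArithmetic.LowPrec.SR
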